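import Mathlib

/-!
# PneNP / BruckRyserSos — relabelings of cell configurations (toolkit for `SosBlindPlanes`)

Route `PneNP/BruckRyserSos`, crux stmt-PneNP-16761 (`SosBlindPlanes`). First file of the proof that
for every fixed degree `d` the projective-plane design system of order `n` admits a degree-`d`
pseudoexpectation for ALL sufficiently large `n` (so in particular at the Bruck–Ryser–Chowla excluded
orders): a transfer of the genuine expectations at prime orders (the planes `PG(2,p)`) to every
large real parameter through the Tarski–Seidenberg theorem, made possible by a symmetry reduction of
the degree-`d` moment problem that is UNIFORM in `n`.

This file is pure finite combinatorics. A CONFIGURATION is a finite set `U` of cells `(a, b)`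
("point `a` lies on line `b`", points in `Fin a`, lines in `Fin b`); `pts U` / `lns U` are the
points / lines it mentions, and `rel f g U` relabels points by `f` and lines by `g`. The two facts
everything else rests on:

* `exists_perm_rel_eq` — two relabelings of the same configuration that are injective on its
  points and on its lines differ by a pair of PERMUTATIONS of the targets (so every
  configuration-invariant quantity takes the same value on both);
* (file `…Counting`) `card_perm_image_subset` — the number of permutations `σ` of a finite type
  `γ` mapping a set `A` into a set `I` is `C(|I|,|A|) · |A|! · (|γ| - |A|)!` (the counting behind
  the template-sum formula for traces of invariant moment matrices, file `…TemplateSum`).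

References: J. Bochnak, M. Coste, M.-F. Roy, *Real Algebraic Geometry* (1998), Thm. 2.2.1 (the
transfer principle this toolkit serves); folklore (orbit counting).
-/

set_option linter.dupNamespace false -- `Summit.PneNP.PneNP.…`: summit = sub-problem name (D-0017 single-conjunct layout)

namespace Summit.PneNP.PneNP.Theorems.SosBlindPlanes

open Finset Function

variable {a b a' b' a'' b'' : ℕ}

/-! ### Points, lines, relabelings -/

/-- The points (first coordinates) mentioned by a configuration of cells. [folklore] -/
def pts (U : Finset (Fin a × Fin b)) : Finset (Fin a) :=
  U.image Prod.fst

/-- The lines (second coordinates) mentioned by a configuration of cells. [folklore] -/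
def lns (U : Finset (Fin a × Fin b)) : Finset (Fin b) :=
  U.image Prod.snd

/-- Relabel a configuration: points through `f`, lines through `g`. [folklore] -/
def rel (f : Fin a → Fin a') (g : Fin b → Fin b') (U : Finset (Fin a × Fin b)) :
    Finset (Fin a' × Fin b') :=
  U.image (Prod.map f g)

/-- Membership in `pts`. [folklore] -/
theorem mem_pts {U : Finset (Fin a × Fin b)} {p : Fin a} : p ∈ pts U ↔ ∃ q, (p, q) ∈ U := by
  simp [pts]

/-- Membership in `lns`. [folklore] -/
theorem mem_lns {U : Finset (Fin a × Fin b)} {q : Fin b} : q ∈ lns U ↔ ∃ p, (p, q) ∈ U := by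
  simp [lns]

/-- The point of a cell of `U` is a point of `U`. [folklore] -/
theorem fst_mem_pts {U : Finset (Fin a × Fin b)} {c : Fin a × Fin b} (h : c ∈ U) : c.1 ∈ pts U :=
  mem_pts.2 ⟨c.2, h⟩

/-- The line of a cell of `U` is a line of `U`. [folklore] -/
theorem snd_mem_lns {U : Finset (Fin a × Fin b)} {c : Fin a × Fin b} (h : c ∈ U) : c.2 ∈ lns U :=
  mem_lns.2 ⟨c.1, h⟩

/-- Membership in a relabeled configuration. [folklore] -/
theorem mem_rel {f : Fin a → Fin a'} {g : Fin b → Fin b'} {U : Finset (Fin a × Fin b)}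
    {c : Fin a' × Fin b'} : c ∈ rel f g U ↔ ∃ c' ∈ U, (f c'.1, g c'.2) = c := by
  simp [rel, Prod.map]

/-- The relabeled cell of a cell of `U` lies in the relabeled configuration. [folklore] -/
theorem mem_rel_of_mem {f : Fin a → Fin a'} {g : Fin b → Fin b'} {U : Finset (Fin a × Fin b)}
    {c : Fin a × Fin b} (h : c ∈ U) : (f c.1, g c.2) ∈ rel f g U :=
  mem_rel.2 ⟨c, h, rfl⟩

/-- Relabeling the empty configuration. [folklore] -/
@[simp] theorem rel_empty (f : Fin a → Fin a') (g : Fin b → Fin b') :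
    rel f g (∅ : Finset (Fin a × Fin b)) = ∅ := by
  simp [rel]

/-- Relabeling a one-cell configuration. [folklore] -/
@[simp] theorem rel_singleton (f : Fin a → Fin a') (g : Fin b → Fin b') (c : Fin a × Fin b) :
    rel f g {c} = {(f c.1, g c.2)} := by
  simp [rel, Prod.map]

/-- Relabeling commutes with unions. [folklore] -/
theorem rel_union (f : Fin a → Fin a') (g : Fin b → Fin b') (U W : Finset (Fin a × Fin b)) :
    rel f g (U ∪ W) = rel f g U ∪ rel f g W := by
  simp [rel, image_union]

/-- Relabeling commutes with insertion of a cell. [folklore] -/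
theorem rel_insert (f : Fin a → Fin a') (g : Fin b → Fin b') (c : Fin a × Fin b)
    (U : Finset (Fin a × Fin b)) : rel f g (insert c U) = insert (f c.1, g c.2) (rel f g U) := by
  simp [rel, image_insert, Prod.map]

/-- Relabeling is monotone. [folklore] -/
theorem rel_mono (f : Fin a → Fin a') (g : Fin b → Fin b') {U W : Finset (Fin a × Fin b)}
    (h : U ⊆ W) : rel f g U ⊆ rel f g W :=
  image_subset_image h

/-- The empty configuration has no points. [folklore] -/
@[simp] theorem pts_empty : pts (∅ : Finset (Fin a × Fin b)) = ∅ := by simp [pts]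

/-- The empty configuration has no lines. [folklore] -/
@[simp] theorem lns_empty : lns (∅ : Finset (Fin a × Fin b)) = ∅ := by simp [lns]

/-- Points of a union. [folklore] -/
theorem pts_union (U W : Finset (Fin a × Fin b)) : pts (U ∪ W) = pts U ∪ pts W := by
  simp [pts, image_union]

/-- Lines of a union. [folklore] -/
theorem lns_union (U W : Finset (Fin a × Fin b)) : lns (U ∪ W) = lns U ∪ lns W := by
  simp [lns, image_union]

/-- Points of a one-cell configuration. [folklore] -/
@[simp] theorem pts_singleton (c : Fin a × Fin b) : pts ({c} : Finset (Fin a × Fin b)) = {c.1} := by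
  simp [pts]

/-- Lines of a one-cell configuration. [folklore] -/
@[simp] theorem lns_singleton (c : Fin a × Fin b) : lns ({c} : Finset (Fin a × Fin b)) = {c.2} := by
  simp [lns]

/-- Points after inserting a cell. [folklore] -/
theorem pts_insert (c : Fin a × Fin b) (U : Finset (Fin a × Fin b)) :
    pts (insert c U) = insert c.1 (pts U) := by
  simp [pts, image_insert]

/-- Lines after inserting a cell. [folklore] -/
theorem lns_insert (c : Fin a × Fin b) (U : Finset (Fin a × Fin b)) :
    lns (insert c U) = insert c.2 (lns U) := by
  simp [lns, image_insert]

/-- `pts` is monotone. [folklore] -/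
theorem pts_mono {U W : Finset (Fin a × Fin b)} (h : U ⊆ W) : pts U ⊆ pts W :=
  image_subset_image h

/-- `lns` is monotone. [folklore] -/
theorem lns_mono {U W : Finset (Fin a × Fin b)} (h : U ⊆ W) : lns U ⊆ lns W :=
  image_subset_image h

/-- A configuration has at most as many points as cells. [folklore] -/
theorem card_pts_le (U : Finset (Fin a × Fin b)) : (pts U).card ≤ U.card :=
  card_image_le

/-- A configuration has at most as many lines as cells. [folklore] -/
theorem card_lns_le (U : Finset (Fin a × Fin b)) : (lns U).card ≤ U.card :=
  card_image_le

/-- Points of a relabeled configuration. [folklore] -/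
theorem pts_rel (f : Fin a → Fin a') (g : Fin b → Fin b') (U : Finset (Fin a × Fin b)) :
    pts (rel f g U) = (pts U).image f := by
  ext p
  simp only [mem_pts, mem_rel, mem_image, Prod.exists, Prod.mk.injEq]
  constructor
  · rintro ⟨q, p', q', h, rfl, rfl⟩
    exact ⟨p', ⟨q', h⟩, rfl⟩
  · rintro ⟨p', ⟨q', h⟩, rfl⟩
    exact ⟨g q', p', q', h, rfl, rfl⟩

/-- Lines of a relabeled configuration. [folklore] -/
theorem lns_rel (f : Fin a → Fin a') (g : Fin b → Fin b') (U : Finset (Fin a × Fin b)) :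
    lns (rel f g U) = (lns U).image g := by
  ext q
  simp only [mem_lns, mem_rel, mem_image, Prod.exists, Prod.mk.injEq]
  constructor
  · rintro ⟨p, p', q', h, rfl, rfl⟩
    exact ⟨q', ⟨p', h⟩, rfl⟩
  · rintro ⟨q', ⟨p', h⟩, rfl⟩
    exact ⟨f p', p', q', h, rfl, rfl⟩

/-- Composition of relabelings. [folklore] -/
theorem rel_rel (f : Fin a → Fin a') (g : Fin b → Fin b') (f' : Fin a' → Fin a'')
    (g' : Fin b' → Fin b'') (U : Finset (Fin a × Fin b)) :
    rel f' g' (rel f g U) = rel (f' ∘ f) (g' ∘ g) U := by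
  simp [rel, image_image, Prod.map_comp_map]

/-- The identity relabeling. [folklore] -/
@[simp] theorem rel_id (U : Finset (Fin a × Fin b)) : rel id id U = U := by
  simp [rel]

/-- Relabelings agreeing on the points and lines of `U` agree on `U`. [folklore] -/
theorem rel_congr {f f' : Fin a → Fin a'} {g g' : Fin b → Fin b'} {U : Finset (Fin a × Fin b)}
    (h1 : ∀ p ∈ pts U, f p = f' p) (h2 : ∀ q ∈ lns U, g q = g' q) : rel f g U = rel f' g' U := by
  apply image_congr
  intro c hc
  simp only [Prod.map, mem_coe] at hc ⊢
  rw [h1 _ (fst_mem_pts hc), h2 _ (snd_mem_lns hc)]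

/-- A relabeling injective on the points and on the lines of `U` is injective on `U`.
[folklore] -/
theorem injOn_prodMap {f : Fin a → Fin a'} {g : Fin b → Fin b'} {U : Finset (Fin a × Fin b)}
    (hf : Set.InjOn f (pts U)) (hg : Set.InjOn g (lns U)) :
    Set.InjOn (Prod.map f g) U := by
  intro c hc c' hc' h
  simp only [Prod.map, Prod.mk.injEq] at h
  exact Prod.ext (hf (fst_mem_pts hc) (fst_mem_pts hc') h.1)
    (hg (snd_mem_lns hc) (snd_mem_lns hc') h.2)

/-- A relabeling injective on points and lines preserves the number of cells. [folklore] -/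
theorem card_rel {f : Fin a → Fin a'} {g : Fin b → Fin b'} {U : Finset (Fin a × Fin b)}
    (hf : Set.InjOn f (pts U)) (hg : Set.InjOn g (lns U)) : (rel f g U).card = U.card :=
  card_image_of_injOn (injOn_prodMap hf hg)

/-- Relabeling does not increase the number of cells. [folklore] -/
theorem card_rel_le (f : Fin a → Fin a') (g : Fin b → Fin b') (U : Finset (Fin a × Fin b)) :
    (rel f g U).card ≤ U.card :=
  card_image_le

/-- A relabeling injective on points preserves the number of points. [folklore] -/
theorem card_pts_rel {f : Fin a → Fin a'} (g : Fin b → Fin b') {U : Finset (Fin a × Fin b)}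
    (hf : Set.InjOn f (pts U)) : (pts (rel f g U)).card = (pts U).card := by
  rw [pts_rel]; exact card_image_of_injOn hf

/-- A relabeling injective on lines preserves the number of lines. [folklore] -/
theorem card_lns_rel (f : Fin a → Fin a') {g : Fin b → Fin b'} {U : Finset (Fin a × Fin b)}
    (hg : Set.InjOn g (lns U)) : (lns (rel f g U)).card = (lns U).card := by
  rw [lns_rel]; exact card_image_of_injOn hg

/-- Relabeling does not increase the number of points. [folklore] -/
theorem card_pts_rel_le (f : Fin a → Fin a') (g : Fin b → Fin b') (U : Finset (Fin a × Fin b)) :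
    (pts (rel f g U)).card ≤ (pts U).card := by
  rw [pts_rel]; exact card_image_le

/-- Relabeling does not increase the number of lines. [folklore] -/
theorem card_lns_rel_le (f : Fin a → Fin a') (g : Fin b → Fin b') (U : Finset (Fin a × Fin b)) :
    (lns (rel f g U)).card ≤ (lns U).card := by
  rw [lns_rel]; exact card_image_le

/-- Pulling back along left inverses recovers the configuration. [folklore] -/
theorem rel_rel_eq_self {f : Fin a → Fin a'} {g : Fin b → Fin b'} {f' : Fin a' → Fin a}
    {g' : Fin b' → Fin b} {U : Finset (Fin a × Fin b)}
    (h1 : ∀ p ∈ pts U, f' (f p) = p) (h2 : ∀ q ∈ lns U, g' (g q) = q) :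
    rel f' g' (rel f g U) = U := by
  rw [rel_rel]
  conv_rhs => rw [← rel_id U]
  exact rel_congr (fun p hp => h1 p hp) (fun q hq => h2 q hq)

/-- Injectivity on the points of a relabeled configuration, from injectivity of the composite.
[folklore] -/
theorem injOn_pts_rel {f : Fin a → Fin a'} {f' : Fin a' → Fin a''} (g : Fin b → Fin b')
    {U : Finset (Fin a × Fin b)} (h : Set.InjOn (f' ∘ f) (pts U)) :
    Set.InjOn f' (pts (rel f g U)) := by
  rw [pts_rel]
  intro x hx y hy hxy
  obtain ⟨p, hp, rfl⟩ := mem_image.1 (mem_coe.1 hx)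
  obtain ⟨p', hp', rfl⟩ := mem_image.1 (mem_coe.1 hy)
  rw [h hp hp' hxy]

/-- Injectivity on the lines of a relabeled configuration, from injectivity of the composite. [folklore] -/
theorem injOn_lns_rel (f : Fin a → Fin a') {g : Fin b → Fin b'} {g' : Fin b' → Fin b''}
    {U : Finset (Fin a × Fin b)} (h : Set.InjOn (g' ∘ g) (lns U)) :
    Set.InjOn g' (lns (rel f g U)) := by
  rw [lns_rel]
  intro x hx y hy hxy
  obtain ⟨q, hq, rfl⟩ := mem_image.1 (mem_coe.1 hx)
  obtain ⟨q', hq', rfl⟩ := mem_image.1 (mem_coe.1 hy)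
  rw [h hq hq' hxy]

/-! ### Relabelings injective on a configuration differ by permutations -/

/-- Two maps injective on a finite set `s` into a finite type differ on `s` by a permutation of the
target. [folklore] -/
theorem exists_perm_forall_apply_eq {α γ : Type*} [Fintype γ] [DecidableEq γ] (s : Finset α)
    {f f' : α → γ} (hf : Set.InjOn f s) (hf' : Set.InjOn f' s) :
    ∃ σ : Equiv.Perm γ, ∀ x ∈ s, σ (f x) = f' x := by
  classical
  have hb : Set.BijOn f (s : Set α) (f '' s) := hf.bijOn_image
  have hb' : Set.BijOn f' (s : Set α) (f' '' s) := hf'.bijOn_image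
  let e : (f '' (s : Set α)) ≃ (f' '' (s : Set α)) := (hb.equiv f).symm.trans (hb'.equiv f')
  refine ⟨e.extendSubtype, fun x hx => ?_⟩
  have hfx : f x ∈ f '' (s : Set α) := ⟨x, hx, rfl⟩
  rw [e.extendSubtype_apply_of_mem _ hfx]
  have h1 : (hb.equiv f).symm ⟨f x, hfx⟩ = ⟨x, hx⟩ := by
    rw [Equiv.symm_apply_eq]
    rfl
  simp only [e, Equiv.trans_apply, h1]
  rfl

/-- **Two relabelings of one configuration, each injective on its points and on its lines, differ
by a pair of permutations of the targets.** [folklore] -/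
theorem exists_perm_rel_eq (U : Finset (Fin a × Fin b)) {f f' : Fin a → Fin a'}
    {g g' : Fin b → Fin b'} (hf : Set.InjOn f (pts U)) (hf' : Set.InjOn f' (pts U))
    (hg : Set.InjOn g (lns U)) (hg' : Set.InjOn g' (lns U)) :
    ∃ (σ : Equiv.Perm (Fin a')) (τ : Equiv.Perm (Fin b')), rel σ τ (rel f g U) = rel f' g' U := by
  obtain ⟨σ, hσ⟩ := exists_perm_forall_apply_eq (pts U) hf hf'
  obtain ⟨τ, hτ⟩ := exists_perm_forall_apply_eq (lns U) hg hg'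
  refine ⟨σ, τ, ?_⟩
  rw [rel_rel]
  exact rel_congr (fun p hp => hσ p hp) (fun q hq => hτ q hq)

/-- A finite set of size at most `|γ|` injects into `γ`: some map is injective on it (the target
being nonempty). [folklore] -/
theorem exists_injOn_of_card_le {α γ : Type*} [Fintype γ] [Nonempty γ] (s : Finset α)
    (hs : s.card ≤ Fintype.card γ) : ∃ f : α → γ, Set.InjOn f s := by
  classical
  obtain ⟨e⟩ : Nonempty (s ↪ γ) := Function.Embedding.nonempty_of_card_le (by simpa using hs)
  refine ⟨fun x => if h : x ∈ s then e ⟨x, h⟩ else Classical.arbitrary γ, ?_⟩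
  intro x hx y hy h
  simp only [mem_coe] at hx hy
  simp only [hx, hy, dite_true] at h
  exact congrArg Subtype.val (e.injective h)

/-- Inside one pair of finite types: a configuration with few points and few lines can be moved by
a pair of permutations into prescribed sets of points and lines of sufficient size. [folklore] -/
theorem exists_perm_rel_subset (U : Finset (Fin a × Fin b)) (I : Finset (Fin a))
    (J : Finset (Fin b)) (hI : (pts U).card ≤ I.card) (hJ : (lns U).card ≤ J.card) :
    ∃ (σ : Equiv.Perm (Fin a)) (τ : Equiv.Perm (Fin b)),
      pts (rel σ τ U) ⊆ I ∧ lns (rel σ τ U) ⊆ J := by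
  classical
  -- inject the points of `U` into `I` and the lines into `J`, then extend to permutations
  obtain ⟨eI⟩ : Nonempty (pts U ↪ I) := Function.Embedding.nonempty_of_card_le (by simpa using hI)
  obtain ⟨eJ⟩ : Nonempty (lns U ↪ J) := Function.Embedding.nonempty_of_card_le (by simpa using hJ)
  let f : Fin a → Fin a := fun p => if h : p ∈ pts U then (eI ⟨p, h⟩ : Fin a) else p
  let g : Fin b → Fin b := fun q => if h : q ∈ lns U then (eJ ⟨q, h⟩ : Fin b) else q
  have hf : Set.InjOn f (pts U) := by
    intro p hp p' hp' h
    simp only [mem_coe] at hp hp'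
    simp only [f, hp, hp', dite_true] at h
    exact congrArg Subtype.val (eI.injective (Subtype.val_injective h))
  have hg : Set.InjOn g (lns U) := by
    intro q hq q' hq' h
    simp only [mem_coe] at hq hq'
    simp only [g, hq, hq', dite_true] at h
    exact congrArg Subtype.val (eJ.injective (Subtype.val_injective h))
  obtain ⟨σ, τ, hστ⟩ := exists_perm_rel_eq U (f := id) (f' := f) (g := id) (g' := g)
    (Set.injOn_id _) hf (Set.injOn_id _) hg
  rw [rel_id] at hστ
  refine ⟨σ, τ, ?_, ?_⟩
  · rw [hστ, pts_rel]
    intro p hp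
    obtain ⟨p', hp', rfl⟩ := mem_image.1 hp
    simp only [f, hp', dite_true]
    exact coe_mem _
  · rw [hστ, lns_rel]
    intro q hq
    obtain ⟨q', hq', rfl⟩ := mem_image.1 hq
    simp only [g, hq', dite_true]
    exact coe_mem _

end Summit.PneNP.PneNP.Theorems.SosBlindPlanes
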